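import Summits.KontsevichZagierPeriods.KontsevichZagierPeriods.Theorems.LinRedNormalFormArrangementNormalFormSeparateTwoGeneric

/-!
# Contracting all atom clusters at once costs a log-power

(Line `janus-bands`, crux `ArrangementNormalForm`, stub `stub_separateTwo`, part `Contract`.)
Second USE of the comparison toolkit, the sibling of part `Generic` with window contractions
instead of shifts: if every atom in use sits within `ℓ/2` of its ANCHOR, distinct anchors are
`3ρ + ℓ`-separated (`ρ ≥ 2ℓ`), and `α'` is obtained from `α` by contracting every cluster
exactly by the factor `s ∈ (0, 1]` about its anchor, then `mass(α') ≤ A^{k·#U} · mass(α)`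
(`lmass_contract`, registered as `separateTwo_contract`), where `A` is the ratio constant of
the single window contraction supplied abstractly through the hypothesis `hwin` — discharged by
`separateTwo_window` (part `Window`) with `A = 3 · wexp ℓ ρ s = O(1 + log(1/s))`. In the crux:
`α` is the atom valuation at a base point of a GOOD sector, `α'` at the point of the THIN sector
on the same transversal (angular comparison at a touching vertex or across an atom line; anchors
= values on the special ray), or `α` at radius `r₀` and `α'` at radius `r` on the same ray through
a rational point (radial comparison; anchors = values at the point, `s = r/r₀`).
-/

noncomputable section

open Set MeasureTheory
open scoped ENNReal

namespace Summit.KontsevichZagierPeriods.ArrangementNormalForm.JanusBands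

namespace SepTwo

variable {k : ℕ} {ι : Type*}

/-- **Contraction lemma.** See the module docstring. -/
theorem lmass_contract (lo hi : Fin k → Fin k ⊕ ι) (a : Fin k → Option ι) (U : Finset ι)
    (hlo : ∀ i c, lo i = Sum.inr c → c ∈ U) (hhi : ∀ i c, hi i = Sum.inr c → c ∈ U)
    (ha : ∀ i c, a i = some c → c ∈ U) (α α' anc : ι → ℝ) (s ℓ ρ A : ℝ) (hA : 1 ≤ A)
    (hs : 0 < s ∧ s ≤ 1) (hℓ : 0 < ℓ ∧ 2 * ℓ ≤ ρ)
    (hcore : ∀ c ∈ U, |α c - anc c| ≤ ℓ / 2)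
    (hsep : ∀ c ∈ U, ∀ c' ∈ U, anc c ≠ anc c' → 3 * ρ + ℓ ≤ |anc c - anc c'|)
    (hcontr : ∀ c ∈ U, α' c = anc c + s * (α c - anc c))
    (hwin : ∀ m : ℝ, ∃ (ψ ψ' : ℝ → ℝ) (B : Finset ℝ), StrictMono ψ ∧ Function.Surjective ψ ∧
      (∀ x, x ∉ (B : Set ℝ) → HasDerivAt ψ (ψ' x) x) ∧ (∀ x, 0 ≤ ψ' x ∧ ψ' x ≤ A) ∧
      (∀ x γ, x ∉ (B : Set ℝ) → (|γ - m| ≤ ℓ / 2 ∨ 3 * ρ ≤ |γ - m|) →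
        ψ' x * |x - γ| ≤ A * |ψ x - ψ γ|) ∧
      (∀ x, |x - m| ≤ ℓ → ψ x = m + s * (x - m)) ∧ (∀ x, ρ ≤ |x - m| → ψ x = x)) :
    lmass lo hi a α' ≤ ENNReal.ofReal A ^ (k * U.card) * lmass lo hi a α := by
  classical
  obtain ⟨hs0, hs1⟩ := hs
  obtain ⟨hℓ0, hρ⟩ := hℓ
  set V := U.image anc with hV
  let β : Finset ℝ → ι → ℝ := fun T c => if anc c ∈ T then α' c else α c
  have hβ : ∀ T c, β T c = if anc c ∈ T then α' c else α c := fun T c => rfl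
  -- atoms of other clusters, before or after contraction, are far from an anchor
  have hfar : ∀ c ∈ U, ∀ v ∈ V, anc c ≠ v → 3 * ρ ≤ |α c - v| ∧ 3 * ρ ≤ |α' c - v| := by
    intro c hc v hv hne
    obtain ⟨c', hc'U, hc'⟩ := Finset.mem_image.1 hv
    have h1 : 3 * ρ + ℓ ≤ |anc c - v| := hc' ▸ hsep c hc c' hc'U (hc'.symm ▸ hne)
    have h2 := hcore c hc
    have h3 : |α' c - anc c| ≤ ℓ / 2 := by
      rw [hcontr c hc, show anc c + s * (α c - anc c) - anc c = s * (α c - anc c) by ring, abs_mul,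
        abs_of_pos hs0]
      nlinarith [abs_nonneg (α c - anc c)]
    have t1 := abs_sub_abs_le_abs_sub (anc c - v) (anc c - α c)
    have t2 := abs_sub_abs_le_abs_sub (anc c - v) (anc c - α' c)
    rw [show anc c - v - (anc c - α c) = α c - v by ring, abs_sub_comm (anc c) (α c)] at t1
    rw [show anc c - v - (anc c - α' c) = α' c - v by ring, abs_sub_comm (anc c) (α' c)] at t2
    constructor <;> linarith
  have hP : ∀ T : Finset ℝ, T ⊆ V →
      lmass lo hi a (β T) ≤ ENNReal.ofReal A ^ (k * T.card) * lmass lo hi a α := by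
    intro T
    induction T using Finset.induction_on with
    | empty =>
      intro _
      have : β ∅ = α := funext fun c => by simp [hβ]
      rw [this]; simp
    | insert v T hv ih =>
      intro hsub
      have hvV : v ∈ V := hsub (Finset.mem_insert_self v T)
      obtain ⟨ψ, ψ', B, hmono, hsurj, hder, hbd, hrat, hcoreψ, hfarψ⟩ := hwin v
      -- position of the current values relative to the window at `v`
      have hpos : ∀ c ∈ U, (anc c = v → β T c = α c ∧ |α c - v| ≤ ℓ / 2) ∧
          (anc c ≠ v → 3 * ρ ≤ |β T c - v|) := by
        intro c hcU
        constructor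
        · intro h1
          have hT : anc c ∉ T := h1 ▸ hv
          exact ⟨by rw [hβ, if_neg hT], h1 ▸ hcore c hcU⟩
        · intro h1
          obtain ⟨f1, f2⟩ := hfar c hcU v hvV h1
          rw [hβ]; split_ifs
          · exact f2
          · exact f1
      have hagree : ∀ c ∈ U, (ψ ∘ β T) c = β (insert v T) c := by
        intro c hcU
        simp only [Function.comp_apply]
        by_cases h1 : anc c = v
        · obtain ⟨e1, e2⟩ := (hpos c hcU).1 h1
          rw [e1, hcoreψ _ (by linarith), hβ, if_pos (Finset.mem_insert.2 (Or.inl h1)),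
            hcontr c hcU, h1]
        · have e := (hpos c hcU).2 h1
          rw [hfarψ _ (by linarith), hβ, hβ]
          simp only [Finset.mem_insert, h1, false_or]
      have hcongr : lmass lo hi a (β (insert v T)) = lmass lo hi a (ψ ∘ β T) :=
        lmass_congr lo hi a (fun i c h => (hagree c (hlo i c h)).symm)
          (fun i c h => (hagree c (hhi i c h)).symm) (fun i c h => (hagree c (ha i c h)).symm)
      have hletters : ∀ x, x ∉ (B : Set ℝ) → ∀ i c, a i = some c →
          ψ' x * |x - β T c| ≤ A * |ψ x - ψ (β T c)| := by
        intro x hx i c hic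
        refine hrat x _ hx ?_
        by_cases h1 : anc c = v
        · obtain ⟨e1, e2⟩ := (hpos c (ha i c hic)).1 h1
          exact Or.inl (by rw [e1]; exact e2)
        · exact Or.inr ((hpos c (ha i c hic)).2 h1)
      have hstep := lmass_comp_le lo hi a (β T) B (zero_le_one.trans hA) hmono hsurj hder
        (fun x _ => (hbd x).1) (fun x _ => (hbd x).2) hletters
      have ih' := ih ((Finset.subset_insert v T).trans hsub)
      rw [hcongr, Finset.card_insert_of_notMem hv, Nat.mul_succ, pow_add]
      calc lmass lo hi a (ψ ∘ β T) ≤ ENNReal.ofReal A ^ k * lmass lo hi a (β T) := hstep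
        _ ≤ ENNReal.ofReal A ^ k * (ENNReal.ofReal A ^ (k * T.card) * lmass lo hi a α) :=
            mul_le_mul_right ih' _
        _ = ENNReal.ofReal A ^ (k * T.card) * ENNReal.ofReal A ^ k * lmass lo hi a α := by ring
  have hfin : lmass lo hi a α' = lmass lo hi a (β V) := by
    have hag : ∀ c ∈ U, α' c = β V c := fun c hc => by
      rw [hβ, if_pos (Finset.mem_image_of_mem anc hc)]
    exact lmass_congr lo hi a (fun i c h => hag c (hlo i c h)) (fun i c h => hag c (hhi i c h))
      (fun i c h => hag c (ha i c h))
  have h3 : (1 : ℝ≥0∞) ≤ ENNReal.ofReal A := by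
    rw [← ENNReal.ofReal_one]; exact ENNReal.ofReal_le_ofReal hA
  have hcard : k * V.card ≤ k * U.card := Nat.mul_le_mul_left k Finset.card_image_le
  rw [hfin]
  exact (hP V subset_rfl).trans (mul_le_mul_left (pow_le_pow_right₀ h3 hcard) _)

/-- **Rigid cluster shifts.** The cluster version of `lmass_perturb` (part `Generic`): atoms within
`ℓ` of `2ρ+2ℓ`-separated anchors, every cluster translated rigidly by `dlt (anchor)`,
`|dlt| ≤ (ρ−ℓ)/2`, cost at most `3^{k·#U}` given local shifts (hypothesis `hshift`, discharged by
`separateTwo_shift`). In the crux: translation of the base point parallel to a rational line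
`Λ` near a non-rational point of `Λ` (the `Λ`-classes of atoms move rigidly, uniformly in the
distance to `Λ`). -/
theorem lmass_perturb_clusters (lo hi : Fin k → Fin k ⊕ ι) (a : Fin k → Option ι) (U : Finset ι)
    (hlo : ∀ i c, lo i = Sum.inr c → c ∈ U) (hhi : ∀ i c, hi i = Sum.inr c → c ∈ U)
    (ha : ∀ i c, a i = some c → c ∈ U) (α α' anc : ι → ℝ) (dlt : ℝ → ℝ) (ℓ ρ : ℝ)
    (hℓ : 0 ≤ ℓ) (hcore : ∀ c ∈ U, |α c - anc c| ≤ ℓ)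
    (hsep : ∀ c ∈ U, ∀ c' ∈ U, anc c ≠ anc c' → 2 * ρ + 2 * ℓ ≤ |anc c - anc c'|)
    (hval : ∀ c ∈ U, α' c = α c + dlt (anc c)) (hdlt : ∀ v, |dlt v| ≤ (ρ - ℓ) / 2)
    (hshift : ∀ m δ : ℝ, |δ| ≤ (ρ - ℓ) / 2 → ∃ (ψ ψ' : ℝ → ℝ) (B : Finset ℝ), StrictMono ψ ∧
      Function.Surjective ψ ∧ (∀ x, x ∉ (B : Set ℝ) → HasDerivAt ψ (ψ' x) x) ∧
      (∀ x, 0 ≤ ψ' x ∧ ψ' x ≤ 3) ∧ (∀ x γ, ψ' x * |x - γ| ≤ 3 * |ψ x - ψ γ|) ∧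
      (∀ x, |x - m| ≤ ℓ → ψ x = x + δ) ∧ (∀ x, ρ ≤ |x - m| → ψ x = x)) :
    lmass lo hi a α' ≤ ENNReal.ofReal 3 ^ (k * U.card) * lmass lo hi a α := by
  classical
  set V := U.image anc with hV
  let β : Finset ℝ → ι → ℝ := fun T c => if anc c ∈ T then α' c else α c
  have hβ : ∀ T c, β T c = if anc c ∈ T then α' c else α c := fun T c => rfl
  have hfar : ∀ c ∈ U, ∀ v ∈ V, anc c ≠ v → ρ ≤ |α c - v| ∧ ρ ≤ |α' c - v| := by
    intro c hc v hv hne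
    obtain ⟨c', hc'U, hc'⟩ := Finset.mem_image.1 hv
    have h1 : 2 * ρ + 2 * ℓ ≤ |anc c - v| := hc' ▸ hsep c hc c' hc'U (hc'.symm ▸ hne)
    have h2 := hcore c hc
    have h3 : |α' c - anc c| ≤ ℓ + (ρ - ℓ) / 2 := by
      rw [hval c hc, show α c + dlt (anc c) - anc c = (α c - anc c) + dlt (anc c) by ring]
      exact (abs_add_le _ _).trans (add_le_add h2 (hdlt _))
    have t1 := abs_sub_abs_le_abs_sub (anc c - v) (anc c - α c)
    have t2 := abs_sub_abs_le_abs_sub (anc c - v) (anc c - α' c)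
    rw [show anc c - v - (anc c - α c) = α c - v by ring, abs_sub_comm (anc c) (α c)] at t1
    rw [show anc c - v - (anc c - α' c) = α' c - v by ring, abs_sub_comm (anc c) (α' c)] at t2
    have hρℓ : 0 ≤ ρ - ℓ := by linarith [abs_nonneg (dlt v), hdlt v]
    constructor <;> linarith
  have hP : ∀ T : Finset ℝ, T ⊆ V →
      lmass lo hi a (β T) ≤ ENNReal.ofReal 3 ^ (k * T.card) * lmass lo hi a α := by
    intro T
    induction T using Finset.induction_on with
    | empty =>
      intro _
      have : β ∅ = α := funext fun c => by simp [hβ]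
      rw [this]; simp
    | insert v T hv ih =>
      intro hsub
      have hvV : v ∈ V := hsub (Finset.mem_insert_self v T)
      obtain ⟨ψ, ψ', B, hmono, hsurj, hder, hbd, hrat, hcoreψ, hfarψ⟩ := hshift v (dlt v) (hdlt v)
      have hagree : ∀ c ∈ U, (ψ ∘ β T) c = β (insert v T) c := by
        intro c hcU
        simp only [Function.comp_apply]
        by_cases h1 : anc c = v
        · have hT : anc c ∉ T := h1 ▸ hv
          rw [hβ, if_neg hT, hcoreψ _ (h1 ▸ hcore c hcU), hβ,
            if_pos (Finset.mem_insert.2 (Or.inl h1)), hval c hcU, h1]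
        · obtain ⟨f1, f2⟩ := hfar c hcU v hvV h1
          rw [hβ, hβ]
          simp only [Finset.mem_insert, h1, false_or]
          split_ifs
          · exact hfarψ _ f2
          · exact hfarψ _ f1
      have hcongr : lmass lo hi a (β (insert v T)) = lmass lo hi a (ψ ∘ β T) :=
        lmass_congr lo hi a (fun i c h => (hagree c (hlo i c h)).symm)
          (fun i c h => (hagree c (hhi i c h)).symm) (fun i c h => (hagree c (ha i c h)).symm)
      have hstep := lmass_comp_le lo hi a (β T) B (show (0 : ℝ) ≤ 3 by norm_num) hmono hsurj hder
        (fun x _ => (hbd x).1) (fun x _ => (hbd x).2) (fun x _ i c _ => hrat x (β T c))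
      have ih' := ih ((Finset.subset_insert v T).trans hsub)
      rw [hcongr, Finset.card_insert_of_notMem hv, Nat.mul_succ, pow_add]
      calc lmass lo hi a (ψ ∘ β T) ≤ ENNReal.ofReal 3 ^ k * lmass lo hi a (β T) := hstep
        _ ≤ ENNReal.ofReal 3 ^ k * (ENNReal.ofReal 3 ^ (k * T.card) * lmass lo hi a α) :=
            mul_le_mul_right ih' _
        _ = ENNReal.ofReal 3 ^ (k * T.card) * ENNReal.ofReal 3 ^ k * lmass lo hi a α := by ring
  have hfin : lmass lo hi a α' = lmass lo hi a (β V) := by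
    have hag : ∀ c ∈ U, α' c = β V c := fun c hc => by
      rw [hβ, if_pos (Finset.mem_image_of_mem anc hc)]
    exact lmass_congr lo hi a (fun i c h => hag c (hlo i c h)) (fun i c h => hag c (hhi i c h))
      (fun i c h => hag c (ha i c h))
  have h3 : (1 : ℝ≥0∞) ≤ ENNReal.ofReal 3 := by
    rw [← ENNReal.ofReal_one]; exact ENNReal.ofReal_le_ofReal (by norm_num)
  have hcard : k * V.card ≤ k * U.card := Nat.mul_le_mul_left k Finset.card_image_le
  rw [hfin]
  exact (hP V subset_rfl).trans (mul_le_mul_left (pow_le_pow_right₀ h3 hcard) _)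

end SepTwo

/-- **Contracting all atom clusters at once** (registered sub-goal of `stub_separateTwo`;
literal form of `SepTwo.lmass_contract`): atoms within `ℓ/2` of `3ρ+ℓ`-separated anchors,
`α'` = contraction of `α` by `s` about the anchors, cost at most `A^{k·#U}` given single window
contractions with ratio constant `A ≥ 1` (hypothesis `hwin`, discharged by `separateTwo_window`
with `A = 3 · SepTwo.wexp ℓ ρ s`). -/
theorem separateTwo_contract (k : ℕ) (ι : Type) (lo hi : Fin k → Fin k ⊕ ι) (a : Fin k → Option ι) (U : Finset ι) (hlo : ∀ i c, lo i = Sum.inr c → c ∈ U) (hhi : ∀ i c, hi i = Sum.inr c → c ∈ U) (ha : ∀ i c, a i = some c → c ∈ U) (α α' anc : ι → ℝ) (s ℓ ρ A : ℝ) (hA : 1 ≤ A) (hs : 0 < s ∧ s ≤ 1) (hℓ : 0 < ℓ ∧ 2 * ℓ ≤ ρ) (hcore : ∀ c ∈ U, |α c - anc c| ≤ ℓ / 2) (hsep : ∀ c ∈ U, ∀ c' ∈ U, anc c ≠ anc c' → 3 * ρ + ℓ ≤ |anc c - anc c'|) (hcontr : ∀ c ∈ U, α' c = anc c + s * (α c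 - anc c)) (hwin : ∀ m : ℝ, ∃ (ψ ψ' : ℝ → ℝ) (B : Finset ℝ), StrictMono ψ ∧ Function.Surjective ψ ∧ (∀ x, x ∉ (B : Set ℝ) → HasDerivAt ψ (ψ' x) x) ∧ (∀ x, 0 ≤ ψ' x ∧ ψ' x ≤ A) ∧ (∀ x γ, x ∉ (B : Set ℝ) → (|γ - m| ≤ ℓ / 2 ∨ 3 * ρ ≤ |γ - m|) → ψ' x * |x - γ| ≤ A * |ψ x - ψ γ|) ∧ (∀ x, |x - m| ≤ ℓ → ψ x = m + s * (x - m)) ∧ (∀ x, ρ ≤ |x - m| → ψ x = x)) : MeasureTheory.lintegral (MeasureTheory.volume.restrict {t : Fin k → ℝ | ∀ i, Sum.elim t α' (lo i) < t i ∧ t i < Sum.elim t α' (hi i)}) (fun t => ∏ i, (a i).elim 1 (fun c => ENNReal.ofReal |t i - α' c|⁻¹)) ≤ ENNReal.ofReal A ^ (k * U.card) * MeasureTheory.lintegral (MeasureTheory.volume.restrict {t : Fin k → ℝ | ∀ i, Sum.elim t α (lo i) < t i ∧ t i < Sum.elim t α (hi i)}) (fun t => ∏ i, (a i).elim 1 (fun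 c => ENNReal.ofReal |t i - α c|⁻¹)) := by
  exact SepTwo.lmass_contract lo hi a U hlo hhi ha α α' anc s ℓ ρ A hA hs hℓ hcore hsep hcontr hwin

end Summit.KontsevichZagierPeriods.ArrangementNormalForm.JanusBands
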